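import Summits.RiemannHypothesis.RiemannHypothesis.Theorems.SignConeGapRungDefs
import Summits.RiemannHypothesis.RiemannHypothesis.Theorems.SignConeGapRungOneErasure

/-!
# `GapRung 1`, stub `stub_gap_small` (`2 ≤ n₀ ≤ 11`) of line `gap-rung-one`
(crux `SignConeInequality`, stmt-RiemannHypothesis-16301; cell `Cruxes/SignConeInequality/`)

The registered regime stub, verbatim: `∀ n₀ : ℕ, 2 ≤ n₀ → n₀ ≤ 11 → ∀ a : ℝ, 0 < a → SingleGapAt n₀ a`
(`SingleGapAt`, `Theorems/SignConeGapRungDefs.lean`).  It is the erasure theorem `singleGap_erasure` (`n₀ ≤ 12`,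
`Theorems/SignConeGapRungOneErasure.lean`: the plain pointwise certificate `pwCert13s` of the cutoff rung `13/10`, whose
taper is `≤ 1`, erases legally beyond `13/5 > log 13`) read through the route's cone note (the item's `M`-form is
definitionally `Re (weilPolarTerm F + weilArchTerm F)`); the lower bound `2 ≤ n₀` and the cutoff are not used.
-/

noncomputable section

-- `Summit.RiemannHypothesis.RiemannHypothesis.…` repeats a namespace component by design (D-0017 layout).
set_option linter.dupNamespace false

open scoped BigOperators ComplexConjugate

namespace Summit.RiemannHypothesis.RiemannHypothesis.Theorems.SignCone

open Literature.NumberTheory.LFunctions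

/-- **Stub `stub_gap_small`** (line `gap-rung-one`, rung `GapRung 1`): one dirty node gap at `2 ≤ n₀ ≤ 11`, every cutoff. -/
theorem stub_gap_small : ∀ n₀ : ℕ, 2 ≤ n₀ → n₀ ≤ 11 → ∀ a : ℝ, 0 < a → SingleGapAt n₀ a := by
  intro n₀ _h₁ h₂ a _ha k g hg F hn hgap M
  exact singleGap_erasure (g := g) (F := F) rfl (fun i => (hg i).1) (le_trans h₂ (by norm_num)) hn hgap

end Summit.RiemannHypothesis.RiemannHypothesis.Theorems.SignCone

end
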